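import Summits.QuantumFields.BalabanUV.T4Continuum.Support.ActivityTermDatum

/-!
# NE5 / U3, the wall `ActivityLipschitz₂` made a theorem for the term model — part 2 of 3: THE TERM'S SLOT and SIZE

See part 1 (`ActivityTermDatum`) for the framing, the dictionary and the status of every hypothesis (cell `pub-balaban`,
unit `b2b-balaban-t4-ne5-p2-g15`; Summits-side new work; rung (B)+1 finite T⁴ — NOT infinite volume, NOT mass gap, NOT
Clay, NOT a proof of NE5).  This part APPLIES `T4ActivityTermReach.termSlot_of_reach` to the term model: every one of its
hypotheses is discharged from the reference data `RefAt` at the BASE point, the read-out Lipschitz structure `ReadLip`,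
the one-run `Geometry`, the `Admissible` constants and the two relative displacements; the displaced normalisation and
integrand are identified with the term at the displaced point by `φ_eq_tilt` / `F_eq_tilt`; the bound, decreasing in the
normalisation's modulus, is evaluated at the floor `ζ` (`slot_rhs_mono`).  Output: `norm_term_sub_le` (the per-term
two-species slot with amplitudes `ampOp ρ₀`, `ampHist ρ₀`) and `norm_term_le` (`‖term pt‖ ≤ M′/ζ`).  [folklore]
bookkeeping over §§11–12; no printed estimate is claimed.  No `sorry`, no new axioms.
-/

open MeasureTheory
open scoped BigOperators

namespace Summit.QuantumFields.BalabanUV.T4Continuum.ActivityTermModel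


open Literature.MathematicalPhysics.QuantumFieldTheory.Balaban1983to89.T4ActivityTilt
  (diffForm domForm domForm_nonneg sandwichKer mulKer sqrtKer lorentz)
open Literature.MathematicalPhysics.QuantumFieldTheory.Balaban1983to89.T4ActivityTilt renaming resolvent → kerResolvent
open Literature.MathematicalPhysics.QuantumFieldTheory.Balaban1983to89.T4ActivityTiltPotential (potSum potSum_sub)
open Literature.MathematicalPhysics.QuantumFieldTheory.Balaban1983to89.T4ActivityTiltHistory
  (histPot histPot_sub ReadAdditive ReadUnitBound read_sub_of_additive norm_histPot_read_sub_le)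
open Literature.MathematicalPhysics.QuantumFieldTheory.Balaban1983to89.T4ActivityTermReach (termSlot_of_reach)

variable {Op Hist ι κ S Ω Ω₀ 𝒴 𝒞 : Type*} [Fintype ι] [Fintype κ] [MeasurableSpace Ω] [MeasurableSpace Ω₀]

namespace TermDatum

variable (𝔱 : TermDatum Op Hist ι κ S Ω Ω₀ 𝒴 𝒞) (𝔠 : TermConsts)

/-- [folklore] (pure real bookkeeping) MONOTONICITY of the slot bound of `T4ActivityTermReach.termSlot_of_reach` in the
modulus of the normalisation: every occurrence of `‖z‖` is a denominator under a nonnegative numerator, so the bound at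
`‖z‖ ≥ ζ > 0` is at most the bound at the floor `ζ`. -/
theorem slot_rhs_mono {A D c₀ E B M' ch ζ z t δh : ℝ} (hA : 0 ≤ A) (hD : 0 ≤ D) (hc₀ : 0 < c₀) (hE : 0 < E)
    (hB : 0 ≤ B) (hM' : 0 ≤ M') (hch : 0 ≤ ch) (ht : 0 ≤ t) (hδh : 0 ≤ δh) (hζ : 0 < ζ) (hz : ζ ≤ z) :
    (A * (2 + D / (c₀ * z)) / E + D / (c₀ * z)) * (B * M' / z) * t + ch * (2 + D / (c₀ * z)) * (B * M' / z) * δh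
      ≤ (A * (2 + D / (c₀ * ζ)) / E + D / (c₀ * ζ)) * (B * M' / ζ) * t
        + ch * (2 + D / (c₀ * ζ)) * (B * M' / ζ) * δh := by
  have hz0 : 0 < z := lt_of_lt_of_le hζ hz
  have h1 : D / (c₀ * z) ≤ D / (c₀ * ζ) := div_le_div_of_nonneg_left hD (by positivity) (by gcongr)
  have h2 : B * M' / z ≤ B * M' / ζ := div_le_div_of_nonneg_left (by positivity) hζ hz
  have h1z : 0 ≤ D / (c₀ * z) := by positivity
  have h2z : 0 ≤ B * M' / z := by positivity
  gcongr

/-! ## §(d) THE PER-TERM TWO-SPECIES SLOT AS A THEOREM OF THE TERM MODEL: reference data at the base point + read-out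
## Lipschitz + admissible constants ⟹ `‖T(q) − T(p)‖ ≤ ampOp·δ_op + ampHist·δ_h` within reach (`δ_op ≤ 1`, `δ_h ≤ ρ₀`) -/

/-- [folklore] **THE TERM'S SLOT** (`T4ActivityTermReach.termSlot_of_reach` APPLIED to the term model; every hypothesis of
that theorem is DISCHARGED from: the reference data `RefAt` at the base point `pt`, the read-out Lipschitz structure
`ReadLip` of the slot, the one-run geometry `Geometry`, the admissible constants `Admissible`, and the two relative
displacements `‖qt.1 − pt.1‖/ϱOp ≤ 1`, `‖qt.2 − pt.2‖/ϱHist ≤ ρ₀`; NOTHING is assumed at the displaced point `qt`). -/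
theorem norm_term_sub_le [NormedAddCommGroup Op] [NormedAddCommGroup Hist] [DecidableEq ι] [DecidableEq κ]
    [DecidableEq 𝒞] {ϱOp ϱHist ρ₀ : ℝ} (hϱOp : 0 < ϱOp) (hϱHist : 0 < ϱHist)
    (hadm : 𝔠.Admissible) (hgeo : 𝔱.Geometry 𝔠) (hlip : 𝔱.ReadLip 𝔠 ϱOp ϱHist) {pt : Op × Hist}
    (href : 𝔱.RefAt 𝔠 pt) (qt : Op × Hist) (ht1 : ‖qt.1 - pt.1‖ / ϱOp ≤ 1) (hδh : ‖qt.2 - pt.2‖ / ϱHist ≤ ρ₀) :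
    ‖𝔱.term qt - 𝔱.term pt‖ ≤
      𝔱.ampOp 𝔠 ρ₀ * (‖qt.1 - pt.1‖ / ϱOp) + 𝔱.ampHist 𝔠 ρ₀ * (‖qt.2 - pt.2‖ / ϱHist) := by
  have ht0 : 0 ≤ ‖qt.1 - pt.1‖ / ϱOp := div_nonneg (norm_nonneg _) hϱOp.le
  have hδh0 : 0 ≤ ‖qt.2 - pt.2‖ / ϱHist := div_nonneg (norm_nonneg _) hϱHist.le
  have hn₀K := 𝔱.n₀K_nonneg 𝔠 hadm.hK''
  have hzB : 𝔱.z pt.1 ≠ 0 := fun h0 => by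
    have := href.hζ; rw [h0, norm_zero] at this; exact absurd this (not_le.2 hadm.hζ)
  -- the history channel: `‖Δ_h(x)‖ ≤ δ_h · n₀K″` uniformly (§12.2)
  have hdomh : ∀ x, ‖𝔱.histForm qt.2 x - 𝔱.histForm pt.2 x‖ ≤ ‖qt.2 - pt.2‖ / ϱHist * 𝔱.n₀K 𝔠 := fun x => by
    have h := norm_histPot_read_sub_le 𝔱.D 𝔱.cubes 𝔱.cubes₀ 𝔱.τ 𝔱.v hϱHist hlip.hadd hlip.hunit hgeo.hv hgeo.hmeet
      hgeo.hpin pt.2 qt.2 x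
    rw [norm_sub_rev pt.2 qt.2] at h
    exact h
  -- measurability of the displaced exponents from the structural measurability of the model
  have hΔopm : AEStronglyMeasurable (fun x =>
      diffForm (𝔱.R₁ qt.1 - 𝔱.R₁ pt.1) (𝔱.kP qt.1 - 𝔱.kP pt.1) (𝔱.Γ qt.1 - 𝔱.Γ pt.1) (𝔱.Xf x) (𝔱.Bf x)
        + potSum 𝔱.D 𝔱.bonds 𝔱.τ (𝔱.kQ qt.1 x - 𝔱.kQ pt.1 x) (𝔱.kR qt.1 x - 𝔱.kR pt.1 x) (𝔱.Bf x)) 𝔱.ν := by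
    have e : (fun x => diffForm (𝔱.R₁ qt.1 - 𝔱.R₁ pt.1) (𝔱.kP qt.1 - 𝔱.kP pt.1) (𝔱.Γ qt.1 - 𝔱.Γ pt.1) (𝔱.Xf x) (𝔱.Bf x)
        + potSum 𝔱.D 𝔱.bonds 𝔱.τ (𝔱.kQ qt.1 x - 𝔱.kQ pt.1 x) (𝔱.kR qt.1 x - 𝔱.kR pt.1 x) (𝔱.Bf x))
        = fun x => 𝔱.opForm qt.1 x - 𝔱.opForm pt.1 x := funext fun x => (𝔱.opForm_sub qt.1 pt.1 x).symm
    rw [e]; exact (hgeo.hopm qt.1).sub (hgeo.hopm pt.1)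
  have hΔhm : AEStronglyMeasurable (fun x => 𝔱.histForm qt.2 x - 𝔱.histForm pt.2 x) 𝔱.ν :=
    (hgeo.hhistm qt.2).sub (hgeo.hhistm pt.2)
  -- `termSlot_of_reach` with every hypothesis discharged
  have h := termSlot_of_reach 𝔱.d hgeo.hd0 hgeo.hsymm hgeo.htri 𝔱.p 𝔱.q
    (𝔱.kL pt.1) (𝔱.kL qt.1 - 𝔱.kL pt.1) (𝔱.kA pt.1) (𝔱.kA qt.1 - 𝔱.kA pt.1) href.hdA
    (𝔱.kP pt.1) (𝔱.kP qt.1 - 𝔱.kP pt.1) href.hP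
    (𝔱.R₁ qt.1 - 𝔱.R₁ pt.1) (𝔱.kP qt.1 - 𝔱.kP pt.1) (𝔱.Γ qt.1 - 𝔱.Γ pt.1)
    𝔱.D 𝔱.bonds 𝔱.cubes 𝔱.cubes₀ 𝔱.τ (fun x => 𝔱.kQ qt.1 x - 𝔱.kQ pt.1 x) (fun x => 𝔱.kR qt.1 x - 𝔱.kR pt.1 x)
    𝔱.w 𝔱.kk 𝔱.v 𝔱.ν (𝔱.F pt) 𝔱.Xf 𝔱.Bf (fun x => 𝔱.histForm qt.2 x - 𝔱.histForm pt.2 x) 𝔱.ν₀ (𝔱.φ pt.1) 𝔱.B₀f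
    (t := ‖qt.1 - pt.1‖ / ϱOp) (δh := ‖qt.2 - pt.2‖ / ϱHist) (ch := 𝔱.n₀K 𝔠)
    (βh := ‖qt.2 - pt.2‖ / ϱHist * 𝔱.n₀K 𝔠) (βbar := 𝔱.βbar 𝔠 ρ₀)
    hadm.hm hadm.hκL hadm.ha hadm.hc hadm.hκA hadm.hcP hadm.hκP hadm.hδ hadm.hK hadm.hκQ hadm.hκR hadm.hW hadm.hKk
    hadm.hK'' ht0 ht1 (mul_nonneg hδh0 hn₀K) hadm.hu hadm.hu₀
    href.hL (fun a' i => by simpa only [Pi.sub_apply] using hlip.hkL qt.1 pt.1 a' i) href.hRA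
    (fun i j => by simpa only [Matrix.sub_apply] using hlip.hkA qt.1 pt.1 i j) href.hC
    (fun a' a'' => by simpa only [Matrix.sub_apply] using hlip.hkP qt.1 pt.1 a' a'')
    hadm.hsA hadm.hsP hadm.hc' hadm.hcP' hadm.hcG
    (fun b b' => by simp only [add_sub_cancel]; rfl) (fun _ _ => rfl) (fun a' b => by simp only [add_sub_cancel]; rfl)
    hgeo.hKι hgeo.hKκ
    (fun x Y hY b hb b' hb' => by simpa only [Pi.sub_apply] using hlip.hkQ qt.1 pt.1 x Y hY b hb b' hb')
    hgeo.hw hgeo.hk hgeo.hW hgeo.hrow hgeo.hcol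
    (fun x Y hY => by simpa only [Pi.sub_apply] using hlip.hkR qt.1 pt.1 x Y hY) hgeo.hv hgeo.hmeet hgeo.hpin
    hdomh (le_of_eq (mul_comm _ _))
    (by unfold βbar
        have h1 : 𝔠.κR * (↑𝔱.cubes₀.card * 𝔠.K'') * (‖qt.1 - pt.1‖ / ϱOp) ≤ 𝔠.κR * 𝔱.n₀K 𝔠 :=
          mul_le_of_le_one_right (mul_nonneg hadm.hκR hn₀K) ht1
        have h2 : ‖qt.2 - pt.2‖ / ϱHist * 𝔱.n₀K 𝔠 ≤ 𝔱.n₀K 𝔠 * ρ₀ := by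
          rw [mul_comm]; exact mul_le_mul_of_nonneg_left hδh hn₀K
        exact add_le_add h1 h2)
    hadm.huu' hadm.hu₀u₀' (hadm.hreach.trans href.hζ)
    href.hF hΔopm hΔhm hgeo.hPm href.hI' href.hM' href.hφ (hgeo.hq₀m _) hgeo.hP₀m href.hI0' href.hM0' hzB
  -- identify the displaced normalisation and integrand with the term at `qt`
  have ez : (∫ y, Complex.exp (-((1 / 2 : ℂ) * ∑ a, ∑ a', (𝔱.B₀f y a : ℂ) * (𝔱.kP qt.1 - 𝔱.kP pt.1) a a'
      * (𝔱.B₀f y a' : ℂ))) • 𝔱.φ pt.1 y ∂𝔱.ν₀) = 𝔱.z qt.1 := by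
    unfold z
    exact integral_congr_ae (Filter.Eventually.of_forall fun y => (𝔱.φ_eq_tilt qt.1 pt.1 y).symm)
  have eI : (∫ x, Complex.exp (-((diffForm (𝔱.R₁ qt.1 - 𝔱.R₁ pt.1) (𝔱.kP qt.1 - 𝔱.kP pt.1) (𝔱.Γ qt.1 - 𝔱.Γ pt.1)
      (𝔱.Xf x) (𝔱.Bf x) + potSum 𝔱.D 𝔱.bonds 𝔱.τ (𝔱.kQ qt.1 x - 𝔱.kQ pt.1 x) (𝔱.kR qt.1 x - 𝔱.kR pt.1 x) (𝔱.Bf x))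
      + (𝔱.histForm qt.2 x - 𝔱.histForm pt.2 x))) • 𝔱.F pt x ∂𝔱.ν) = ∫ x, 𝔱.F qt x ∂𝔱.ν :=
    integral_congr_ae (Filter.Eventually.of_forall fun x => by
      rw [𝔱.F_eq_tilt pt qt x, 𝔱.opForm_sub qt.1 pt.1 x])
  rw [ez, eI] at h
  -- the bound at `‖z(pt)‖ ≥ ζ` is at most the bound at the floor
  have hmono := slot_rhs_mono (A := 𝔠.cG + 𝔠.κQ * 𝔠.W * 𝔠.Kk + Real.exp 1 * 𝔠.u * (𝔠.κR * (↑𝔱.cubes₀.card * 𝔠.K'')))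
    (D := 4 * (𝔠.κP * 𝔠.K) * 𝔠.M₀') (c₀ := Real.exp 1 * 𝔠.u₀) (E := Real.exp 1 * 𝔠.u)
    (B := 2 * Real.exp (𝔱.βbar 𝔠 ρ₀)) (M' := 𝔠.M') (ch := 𝔱.n₀K 𝔠) (t := ‖qt.1 - pt.1‖ / ϱOp)
    (δh := ‖qt.2 - pt.2‖ / ϱHist)
    (by have := hadm.hκQ; have := hadm.hW; have := hadm.hKk; have := hadm.hκR; have := hadm.hK''; have := hadm.hu
        have hcG : 0 ≤ 𝔠.cG := le_trans (by
          have := hadm.hm; have := hadm.hκL; have := hadm.hcP; have := hadm.hc; have := hadm.hκA; have := hadm.hκP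
          have := hadm.hK
          have hc'0 : 0 ≤ 𝔠.c' := le_trans (div_nonneg hadm.hc (by linarith [hadm.hsA])) hadm.hc'
          have hcP'0 : 0 ≤ 𝔠.cP' := le_trans (div_nonneg hadm.hcP (by linarith [hadm.hsP])) hadm.hcP'
          positivity) hadm.hcG
        positivity)
    (by have := hadm.hκP; have := hadm.hK; have := hadm.hM₀'; positivity) (mul_pos (Real.exp_pos 1) hadm.hu₀)
    (mul_pos (Real.exp_pos 1) hadm.hu) (by positivity) hadm.hM' hn₀K ht0 hδh0 hadm.hζ href.hζ
  unfold term ampOp ampHist n₀K at *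
  exact h.2.trans hmono

/-- [folklore] **THE TERM'S SIZE**: at a point carrying reference data, `‖T(pt)‖ ≤ M′/ζ` (the majorant weight
`e^{u′P} ≥ 1` since `u′ > 0` and `P ≥ 0`, and `‖z‖ ≥ ζ`). -/
theorem norm_term_le [NormedAddCommGroup Op] [NormedAddCommGroup Hist] [DecidableEq ι] [DecidableEq κ]
    (hadm : 𝔠.Admissible) {pt : Op × Hist} (href : 𝔱.RefAt 𝔠 pt) : ‖𝔱.term pt‖ ≤ 𝔠.size := by
  have hu' : 0 ≤ 𝔠.u' := by
    have := hadm.hu; have := hadm.hκQ; have := hadm.hW; have := hadm.hKk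
    have hcG : 0 ≤ 𝔠.cG := le_trans (by
      have := hadm.hm; have := hadm.hκL; have := hadm.hcP; have := hadm.hc; have := hadm.hκA; have := hadm.hκP
      have := hadm.hK
      have hc'0 : 0 ≤ 𝔠.c' := le_trans (div_nonneg hadm.hc (by linarith [hadm.hsA])) hadm.hc'
      have hcP'0 : 0 ≤ 𝔠.cP' := le_trans (div_nonneg hadm.hcP (by linarith [hadm.hsP])) hadm.hcP'
      positivity) hadm.hcG
    have := mul_nonneg (mul_nonneg hadm.hκQ hadm.hW) hadm.hKk
    linarith [hadm.huu']
  have hIF : ∫ x, ‖𝔱.F pt x‖ ∂𝔱.ν ≤ 𝔠.M' := by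
    refine le_trans (integral_mono_of_nonneg (Filter.Eventually.of_forall fun x => norm_nonneg _) href.hI'
      (Filter.Eventually.of_forall fun x => ?_)) href.hM'
    have h1 : 1 ≤ Real.exp (𝔠.u' * domForm (𝔱.Xf x) (𝔱.Bf x)) :=
      Real.one_le_exp (mul_nonneg hu' (domForm_nonneg _ _))
    simpa using mul_le_mul_of_nonneg_right h1 (norm_nonneg (𝔱.F pt x))
  have hzpos : 0 < ‖𝔱.z pt.1‖ := lt_of_lt_of_le hadm.hζ href.hζ
  unfold term TermConsts.size
  rw [norm_smul, norm_inv, div_eq_inv_mul]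
  exact mul_le_mul ((inv_le_inv₀ hzpos hadm.hζ).2 href.hζ)
    ((norm_integral_le_integral_norm _).trans hIF) (norm_nonneg _) (inv_nonneg.2 hadm.hζ.le)

end TermDatum

end Summit.QuantumFields.BalabanUV.T4Continuum.ActivityTermModel
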